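import Summits.QuantumFields.YangMills.Theorems.UnitScaleTiltProp7OneFormGreenBlockDivergence
import Summits.QuantumFields.YangMills.Theorems.UnitScaleTiltProp7OneFormGreenBlockColumnKFree
import HarnessLib

/-!
# Route `UnitScaleTilt`, crux K1 «MinimiserStabilityRegPr» (stmt-QuantumFields-19200), EX face, norm_G ∕ h133 road — N6 FILE D letter (dκ), K-FREE MEMBER EDITION:
# **THE DECAYED COVARIANT-DIVERGENCE ROW OF `G₀` ON A BLOCK-SUPPORTED SOURCE, UNDER `Lift`, WITH A MEMBER-FREE CONSTANT `C_D⋆(γ, C_K, δ_K, a₁, r, ε₀; C_g, C)`**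
# — ✓`Prop7OneFormGreenBlockDivergence.norm_symm_DstarL2_GT_le_of_blockSupport` ((dκ) = ★p1 g27's D3 letter (Db)) with every N4-§2 letter FED as in px16 ✓`Prop7OneFormGreenBlockColumnKFree`
# (token-for-token its hypotheses), the decayed VALUE row by px16 ✓`norm_symm_GT_apply_le_of_blockSupport` fed the same way, and the numerics discharged.
# (width seat `ym3-torus-px21` g15; ★p1 g27 CHAIR WORD №30 (2)∕№31 (2); pattern credit px16 g13 D2 (b), knit credit px21 g14 A2i.)

Cell `ym3-torus` (HUMAN RULING D-0037; rung R3 = SU(2) YM₃ on T³ — NOT d = 4, NOT infinite volume, NOT a mass gap, NOT Clay).  THEOREMS ONLY (0 `def`, 0 `sorry`);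
`--supports stmt-QuantumFields-19200 --as helper`; count-neutral.

WHAT IS PROVED (ns `Summit.QuantumFields.YangMills.Theorems.Prop7OneFormGreenBlockDivergenceKFree`).
* §1 numerics (pure reals): `words_le_kfree` (the (D)∕(Q) words `C_Kℓ⁻³·√(3ℓ³∕c₀)·(e^{6r}√(6c₀ℓ³)∕Θ)·(2(1+1∕(δ_K−r)))³ ≤ C_K·3√2·e^{6r}(2∕γ)·(2(1+2∕δ_K))³` and the `Q`-twin with
  `2a·5²(cB∕c₀)ℓ⁻⁶e^{δ_K}·ℓ³ ≤ 50a₁e^{δ_K}`; ✓`sqrt_vol_mul_sqrt_mass_eq`, `Θ ≥ γ∕2`, `r ≤ δ_K∕2`) · `CD_mono` (the printed `C_D` is monotone in its six member-dependent atoms) ·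
  `exp_mul_kappa_le` (`e^{cκ₁} ≤ e^{c∕8}`, `κ₁ = min r ¼∕2 ≤ ⅛`).
* §2 ★★★ `divergence_GT_DeltaEtaSlot_kfree` — HYPOTHESES = px16 ✓`blockColumn_GT_DeltaEtaSlot_kfree`'s VERBATIM (`n < K`; `RegPr` + `10¹²L³ε₀ ≤ 1`, `10¹⁰L⁶ε₀ ≤ 1`, `13·10¹⁴L³ε₀ ≤ 1`;
  `Lift`; coupling window `0 ≤ a ≤ a₁(c₀∕cB)ℓ³`; (γ) `hco`, `0 < γ`; `hk_D` in px10's `C_K·ℓ⁻³·e^{−δ_K d}` currency; budgets `r ≤ ¼`, `r ≤ δ_K∕2`, `0 < ε ≤ ⅛`, `ε·C_V¹ ≤ γ∕8`, `r ≤ γε∕48`,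
  `r·T(a₁,C_K,δ_K) ≤ γ∕16`, `10⁵ε₀ ≤ γ∕16`) + the no-wrap room `2(12ℓ+5) ≤ sitesPerDir` + the K-FREE gradient margin `C_g·(48ε₀(6√2√10 + 6√2))·e^{51∕8} ≤ ½`; CONCLUSION = the (Db)
  TEXT `∀ X z, (∀ b, X b ≠ 0 → B b₋ = z) → ∀ s ≥ 0, (∀ b, ‖X b‖ ≤ s) → ∀ x, ‖toL2S⁻¹(D*_{U₀}(G₀(toL2 X))) x‖ ≤ s·C_D⋆·e^{−κ₁·tdist(B x, z)}` with `C_D⋆` MEMBER-FREE (printed; no `ℓ`,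
  `c₀`, `cB`, `a`, `K`).  PROOF: letters fed (`PosOnto` ⟸ (γ)+✓`surjective_Qk_of_regPr`, `hVconj` ⟸ ✓`hVconj_phaseClass_of_letters`, `hVlow` ⟸ ✓`hVlow_abs_of_lift`, `hkQ` ⟸ ✓`hkQ_of_regPr`,
  `Θ ≥ γ∕2` ⟸ ✓`theta_ge_half_of_budgets` ∘ ✓`thetaV_le_kfree` ∘ ✓`rbudget_le` ∘ ✓`CV_abs_le`, ✓`hsmall_le_half`), `hval` := px16 §3, main := (dκ); then `A_V ≤ ½·C_G` (✓`twoA₂_le_kfree`),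
  §1, and `CD_mono`; the sign of `A_V` is read off the value row at one bond (case `s > 0`; `s = 0` is trivial).
HEARTBEATS (README rule, disclosed): §2 carries a decl-local `set_option maxHeartbeats 400000 in` — measured: fails at the default 200 000 (`isDefEq` on the fed 4-kchar constants while
elaborating the two knits), passes at 300 000; the mathematics is unaffected; §1 is default.
HYP-SAT (★★OWNER RULING №42).  (γ) `hco`, `hk_D`, `Lift`, `RegPr`: the EX face's standing letters (classes of record, inhabited by ✓`hco_DeltaEtaSlot_exists`, ✓`kernelRow349_allMembers_exists`);
the budgets are real inequalities on free parameters (satisfiable: choose `ε`, then `r`, then the `ε₀`-cap — px16's D2 (c) family does exactly this); `hroom` CHAIR WORD №1 class; the margin is a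
smallness of `ε₀` against the universal `C_g` (`Exists.choose` of ✓`exists_curved_localGradient`).  Conclusion non-vacuous; no `Prop` placeholder.
HONEST SCOPE.  Re-knit + real arithmetic; CONDITIONAL on the displayed letters; nothing of FILE D, `h133`, `norm_G`, the EX rows, EX, 19200 or the rung is proved here; the Yang–Mills mass
gap is NOT proved.

References: T. Bałaban, CMP **99** (1985) 389–434 [Balaban1985BackgroundPropagators] ((3.8) p.392, Thm 3.1 (3.42)–(3.47) pp.397–399, (3.49) p.399, Thm 3.11 p.416, Thm 3.12 p.422);
CMP **102** (1985) 277–309 [Balaban1985Variational] ((19) p.281, (134)–(135) p.298).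
-/

set_option autoImplicit false

noncomputable section

open scoped Matrix.Norms.L2Operator BigOperators InnerProductSpace ComplexConjugate

namespace Summit.QuantumFields.YangMills.Theorems.Prop7OneFormGreenBlockDivergenceKFree

open Literature.MathematicalPhysics.QuantumFieldTheory.Balaban1983to89
open Literature.MathematicalPhysics.QuantumFieldTheory.Balaban1983to89.T3ContinuumYM3Torus
open Literature.MathematicalPhysics.QuantumFieldTheory.Balaban1983to89.T3PrintedRegularMinimiser (RegPr)
open B15DeterminingSets (embIter)
open T3SectALandauChart (formComp bgUnits eta eta_pos)
open B9SectCLatticeCarrier (Bond)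
open B9Eq311L2Pairing (WL2)
open B11Eq103H1Complex (BondL2K)
open B5Eq118OneStroke (iterBlockOf)
open Summit.QuantumFields.YangMills.Theorems.Prop8Chart (emlIterU)
open Summit.QuantumFields.YangMills.Theorems.Prop7SectET3Transport (periodsT3 bondEquiv)
open Summit.QuantumFields.YangMills.Theorems.Prop7SectET3HilbertLetters (W₂ frobEquiv toL2 toL2S DL2 DstarL2)
open Summit.QuantumFields.YangMills.Theorems.Prop7SectET3WilsonHessian (DeltaEtaSlot)
open Summit.QuantumFields.YangMills.Theorems.Prop7SectET3GaugeProjector (RS)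
open Summit.QuantumFields.YangMills.Theorems.Prop7SectET3CurvedPropagators (laplaceA Qk GT PosOnto)
open Summit.QuantumFields.YangMills.Theorems.Prop7OneFormAgmonPhaseClass (hVconj_phaseClass_of_letters)
open Summit.QuantumFields.YangMills.Theorems.Prop7QkPenaltyKernelRowOfRegPr (hkQ_of_regPr)
open Summit.QuantumFields.YangMills.Theorems.Prop7QkAdjointSupRowOfRegPr (norm_Qk_le_of_regPr)
open Summit.QuantumFields.YangMills.Theorems.Prop7QkOntoOfRegPr (surjective_Qk_of_regPr)
open Summit.QuantumFields.YangMills.Theorems.Prop7OneFormRemainderFloorOfLift (hVlow_abs_of_lift)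
open Summit.QuantumFields.YangMills.Theorems.Prop7OneFormGreenSupBound (norm_symm_GT_apply_le_of_blockSupport)
open Summit.QuantumFields.YangMills.Theorems.Prop7OneFormGreenKFreeNumerics (sqrt_vol_mul_sqrt_mass_eq twoA₂_le_kfree thetaV_le_kfree hsmall_le_half rbudget_le theta_ge_half_of_budgets CV_abs_le)
open Summit.QuantumFields.YangMills.Theorems.Prop7CurvedMemberLocalGradient (exists_curved_localGradient)
open Summit.QuantumFields.YangMills.Theorems.AxialGaugeChartGlue (norm_bgOfCfg_axialT_sub_le)
open Summit.QuantumFields.YangMills.Theorems.Prop7OneFormGreenBlockDivergence (norm_symm_DstarL2_GT_le_of_blockSupport)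

/-! ## §1 Numerics (pure reals): the K-free majorants of the letters of `C_D` -/

/-- **THE TWO WORDS ARE K-FREE**: `(C_K ℓ⁻³)·√(3ℓ³∕c₀)·(e^{6r}√(2c₀·3ℓ³)∕Θ)·(2(1+1∕(δ_K−r)))³ ≤ C_K·3√2·(e^{6r}·2∕γ)·(2(1+2∕δ_K))³` and the same for the `Q`-word
`2a·5²(cB∕c₀)ℓ⁻⁶e^{δ_K}` with `a ≤ a₁(c₀∕cB)ℓ³` (`≤ 50a₁e^{δ_K}·…`), for `Θ ≥ γ∕2 > 0`, `0 < r ≤ δ_K∕2` (✓`sqrt_vol_mul_sqrt_mass_eq`: `√(3ℓ³∕c₀)√(6c₀ℓ³) = 3√2ℓ³`).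
[cite: Balaban1985BackgroundPropagators, (3.46)–(3.49) pp.398–399] -/
theorem words_le_kfree {d : ℕ} (hd : d = 3) {Lr : ℝ} (hLr : 1 ≤ Lr) (k : ℕ) {c₀ cB : ℝ} (hc₀ : 0 < c₀) (hcB : 0 < cB)
    {a a₁ : ℝ} (ha : 0 ≤ a) (ha₁ : a ≤ a₁ * (c₀ / cB) * (Lr ^ k) ^ 3) {CK δK : ℝ} (hCK : 0 ≤ CK) (hδK : 0 < δK)
    {r : ℝ} (hr : 0 < r) (hrδ : r ≤ δK / 2) {γ Θ : ℝ} (hγ : 0 < γ) (hΘ : γ / 2 ≤ Θ) :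
    CK * (Lr ^ k)⁻¹ ^ 3 * Real.sqrt ((d : ℝ) * ((Lr ^ d) ^ k) / c₀) * (Real.exp (6 * r) * Real.sqrt (2 * c₀ * ((d : ℝ) * ((Lr ^ d) ^ k))) / Θ) * (2 * (1 + 1 / (δK - r))) ^ 3
        ≤ CK * (3 * Real.sqrt 2) * (Real.exp (6 * r) * (2 / γ)) * (2 * (1 + 2 / δK)) ^ 3 ∧
      2 * a * 5 ^ 2 * (cB / c₀) * (Lr ^ k)⁻¹ ^ 6 * Real.exp δK * Real.sqrt ((d : ℝ) * ((Lr ^ d) ^ k) / c₀)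
          * (Real.exp (6 * r) * Real.sqrt (2 * c₀ * ((d : ℝ) * ((Lr ^ d) ^ k))) / Θ) * (2 * (1 + 1 / (δK - r))) ^ 3
        ≤ (50 * a₁ * Real.exp δK) * (3 * Real.sqrt 2) * (Real.exp (6 * r) * (2 / γ)) * (2 * (1 + 2 / δK)) ^ 3 := by
  subst hd
  simp only [Nat.cast_ofNat]
  set ℓ : ℝ := Lr ^ k with hℓ
  have hℓ1 : 1 ≤ ℓ := one_le_pow₀ hLr
  have hℓ0 : 0 < ℓ := lt_of_lt_of_le one_pos hℓ1
  have hℓ3 : (Lr ^ 3) ^ k = ℓ ^ 3 := by rw [hℓ, ← pow_mul, ← pow_mul, mul_comm]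
  rw [hℓ3]
  have hΘ0 : 0 < Θ := lt_of_lt_of_le (by positivity) hΘ
  have hΘinv : 1 / Θ ≤ 2 / γ := by rw [div_le_div_iff₀ hΘ0 hγ]; linarith
  -- the volume × mass cancellation
  have hvm : Real.sqrt (3 * ℓ ^ 3 / c₀) * Real.sqrt (2 * c₀ * (3 * ℓ ^ 3)) = 3 * Real.sqrt 2 * ℓ ^ 3 :=
    sqrt_vol_mul_sqrt_mass_eq hc₀ (by positivity)
  -- the coarse volume factor
  have hdr : 0 < δK - r := by linarith
  have hinv0 : 0 ≤ 1 / (δK - r) := div_nonneg zero_le_one hdr.le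
  have hb0 : 0 ≤ 2 * (1 + 1 / (δK - r)) := by linarith
  have hS0 : 0 ≤ (2 * (1 + 1 / (δK - r))) ^ 3 := pow_nonneg hb0 3
  have hS : (2 * (1 + 1 / (δK - r))) ^ 3 ≤ (2 * (1 + 2 / δK)) ^ 3 := by
    have h1 : 1 / (δK - r) ≤ 2 / δK := by
      rw [div_le_div_iff₀ hdr hδK]; linarith
    exact pow_le_pow_left₀ hb0 (by linarith) 3
  -- regroup both words as `coef · (√·√) · e^{6r} · (1∕Θ) · S`
  have key : ∀ coef : ℝ, 0 ≤ coef →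
      coef * Real.sqrt (3 * ℓ ^ 3 / c₀) * (Real.exp (6 * r) * Real.sqrt (2 * c₀ * (3 * ℓ ^ 3)) / Θ) * (2 * (1 + 1 / (δK - r))) ^ 3
        = (coef * ℓ ^ 3) * (3 * Real.sqrt 2) * (Real.exp (6 * r) * (1 / Θ)) * (2 * (1 + 1 / (δK - r))) ^ 3 := by
    intro coef _
    have : coef * Real.sqrt (3 * ℓ ^ 3 / c₀) * (Real.exp (6 * r) * Real.sqrt (2 * c₀ * (3 * ℓ ^ 3)) / Θ)
        = coef * (Real.sqrt (3 * ℓ ^ 3 / c₀) * Real.sqrt (2 * c₀ * (3 * ℓ ^ 3))) * (Real.exp (6 * r) * (1 / Θ)) := by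
      field_simp
    rw [this, hvm]; ring
  have bound : ∀ coef coefk : ℝ, 0 ≤ coef → coef * ℓ ^ 3 ≤ coefk →
      coef * Real.sqrt (3 * ℓ ^ 3 / c₀) * (Real.exp (6 * r) * Real.sqrt (2 * c₀ * (3 * ℓ ^ 3)) / Θ) * (2 * (1 + 1 / (δK - r))) ^ 3
        ≤ coefk * (3 * Real.sqrt 2) * (Real.exp (6 * r) * (2 / γ)) * (2 * (1 + 2 / δK)) ^ 3 := by
    intro coef coefk hcoef hck
    rw [key coef hcoef]
    have hck0 : 0 ≤ coefk := le_trans (by positivity) hck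
    have h1 : Real.exp (6 * r) * (1 / Θ) ≤ Real.exp (6 * r) * (2 / γ) := mul_le_mul_of_nonneg_left hΘinv (Real.exp_pos _).le
    have hC0 : 0 ≤ Real.exp (6 * r) * (1 / Θ) := mul_nonneg (Real.exp_pos _).le (div_nonneg zero_le_one hΘ0.le)
    have hA : (coef * ℓ ^ 3) * (3 * Real.sqrt 2) ≤ coefk * (3 * Real.sqrt 2) := mul_le_mul_of_nonneg_right hck (by positivity)
    exact mul_le_mul (mul_le_mul hA h1 hC0 (by positivity)) hS hS0 (by positivity)
  refine ⟨bound _ _ (by positivity) (le_of_eq ?_), bound _ _ (by positivity) ?_⟩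
  · rw [mul_assoc, ← mul_pow, inv_mul_cancel₀ hℓ0.ne', one_pow, mul_one]
  · -- `2a·25·(cB∕c₀)·ℓ⁻⁶·e^{δK}·ℓ³ = 50·(a·cB∕(c₀ℓ³))·e^{δK} ≤ 50a₁e^{δK}`
    have hq : a * (cB / (c₀ * ℓ ^ 3)) ≤ a₁ := by
      have := mul_le_mul_of_nonneg_right ha₁ (show 0 ≤ cB / (c₀ * ℓ ^ 3) by positivity)
      have e : a₁ * (c₀ / cB) * ℓ ^ 3 * (cB / (c₀ * ℓ ^ 3)) = a₁ := by field_simp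
      linarith [this, e]
    have e2 : 2 * a * 5 ^ 2 * (cB / c₀) * ℓ⁻¹ ^ 6 * Real.exp δK * ℓ ^ 3 = 50 * (a * (cB / (c₀ * ℓ ^ 3))) * Real.exp δK := by
      field_simp
      ring
    rw [e2]
    have := mul_le_mul_of_nonneg_right (mul_le_mul_of_nonneg_left hq (by norm_num : (0 : ℝ) ≤ 50)) (Real.exp_pos δK).le
    linarith

/-- **THE PRINTED `C_D` IS MONOTONE IN ITS SIX MEMBER-DEPENDENT ATOMS** (`e^{4κ₁}`, `A_V`, `e^{51κ₁}`, `e^{5κ₁}`, the D-word, the Q-word), all other letters nonnegative. [folklore] -/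
theorem CD_mono {Cg cε ε₀ e4 AV e51 e5 WD WQ e4' AV' e51' e5' WD' WQ' : ℝ} (hCg : 0 ≤ Cg) (hcε : 0 ≤ cε) (hε₀ : 0 ≤ ε₀)
    (h4 : 0 ≤ e4) (hAV : 0 ≤ AV) (h51 : 0 ≤ e51) (h5 : 0 ≤ e5) (hWD : 0 ≤ WD) (hWQ : 0 ≤ WQ)
    (l4 : e4 ≤ e4') (lAV : AV ≤ AV') (l51 : e51 ≤ e51') (l5 : e5 ≤ e5') (lWD : WD ≤ WD') (lWQ : WQ ≤ WQ') :
    3 * (e4 * (2 * ((Cg * (((Real.sqrt 2 * AV) * e51) * cε + (Real.sqrt 2 * ((32 * ε₀ * (AV * e5)) + WD + WQ + 1)) * e51)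
        + 2 * Real.sqrt 2 * (48 * ε₀) * ((Real.sqrt 2 * AV) * e51)))))
      ≤ 3 * (e4' * (2 * ((Cg * (((Real.sqrt 2 * AV') * e51') * cε + (Real.sqrt 2 * ((32 * ε₀ * (AV' * e5')) + WD' + WQ' + 1)) * e51')
        + 2 * Real.sqrt 2 * (48 * ε₀) * ((Real.sqrt 2 * AV') * e51'))))) := by
  have hAV' : 0 ≤ AV' := hAV.trans lAV
  have h51' : 0 ≤ e51' := h51.trans l51
  have h5' : 0 ≤ e5' := h5.trans l5
  have h4' : 0 ≤ e4' := h4.trans l4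
  have hWD' : 0 ≤ WD' := hWD.trans lWD
  have hWQ' : 0 ≤ WQ' := hWQ.trans lWQ
  gcongr

/-- `κ₁ := min r ¼ ∕ 2 ≤ ⅛`, so `e^{c·κ₁} ≤ e^{c∕8}` for `c ≥ 0`. [folklore] -/
theorem exp_mul_kappa_le {r c : ℝ} (hc : 0 ≤ c) : Real.exp (c * (min r (1 / 4) / 2)) ≤ Real.exp (c / 8) := by
  apply Real.exp_le_exp.2
  have : min r (1 / 4) / 2 ≤ 1 / 8 := by have := min_le_right r (1 / 4); linarith
  nlinarith


/-! ## §2 ★★★ The K-free member edition of (Db) under `Lift` -/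

section Member

variable (F : T3Family) {n K : ℕ} (h : n ≤ K) (c₀ cB : ℝ) [Fact (0 < c₀)] [Fact (0 < cB)]

set_option maxHeartbeats 400000 in
/-- ★★★ **(dκ)-K: THE DECAYED COVARIANT-DIVERGENCE ROW OF `G₀` ON A BLOCK-SUPPORTED SOURCE, UNDER `Lift`, WITH A MEMBER-FREE CONSTANT** — ✓`norm_symm_DstarL2_GT_le_of_blockSupport`
((dκ), the (Db) letter of ★p1 g27's N6 FILE D3) with every N4-§2 letter FED as in px16 ✓`blockColumn_GT_DeltaEtaSlot_kfree` (its hypotheses VERBATIM: `n < K`; `RegPr` + the three `ε₀` windows;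
`Lift`; the coupling window `0 ≤ a ≤ a₁(c₀∕cB)ℓ³`; (γ) `hco`, `0 < γ`; `hk_D` in px10's `C_K·ℓ⁻³·e^{−δ_K·d}` currency; the budgets `r ≤ ¼`, `r ≤ δ_K∕2`, `ε ≤ ⅛`, `ε·C_V¹ ≤ γ∕8`, `r ≤ γε∕48`,
`r·T(a₁,C_K,δ_K) ≤ γ∕16`, `10⁵ε₀ ≤ γ∕16`), the decayed VALUE row by px16 ✓`norm_symm_GT_apply_le_of_blockSupport` fed the same way, PLUS the no-wrap room and the K-FREE gradient margin
`C_g·(48ε₀(6√2√10 + 6√2))·e^{51∕8} ≤ ½` (`κ₁ ≤ ⅛`).  THEN the (Db) TEXT with the MEMBER-FREE constant `C_D⋆(γ, C_K, δ_K, a₁, r, ε₀; C_g, C)` printed below (no `ℓ`, `c₀`, `cB`, `a`, `K`):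
numerics §1 (`A_V ≤ ½·C_G` by ✓`twoA₂_le_kfree`, the two words by `words_le_kfree`, `e^{cκ₁} ≤ e^{c∕8}`) through `CD_mono`.  CONDITIONAL on (γ) `hco`, `hk_D`, `Lift`, the budgets, `hroom`,
the margin; nothing of FILE D ∕ `h133` ∕ `norm_G` ∕ EX ∕ the crux is proved here.
[cite: Balaban1985BackgroundPropagators, (3.8) p.392, Thm 3.1 (3.42)–(3.47) pp.397–399, (3.49) p.399, Thm 3.11 p.416, Thm 3.12 p.422; Balaban1985Variational, (134)–(135) p.298] -/
theorem divergence_GT_DeltaEtaSlot_kfree (hnK : n < K) {ε₀ : ℝ} (hε₀ : 0 < ε₀) (hWε : 10 ^ 12 * (F.L : ℝ) ^ 3 * ε₀ ≤ 1)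
    (hε10 : 10 ^ 10 * (F.L : ℝ) ^ 6 * ε₀ ≤ 1) (hwin : 13 * 10 ^ 14 * (F.L : ℝ) ^ 3 * ε₀ ≤ 1)
    (U₀ : GaugeField (F.P K) 0 (Matrix.specialUnitaryGroup (Fin 2) ℂ)) (hreg : RegPr F n K ε₀ U₀)
    (hlift : ∀ cf : Site (F.P K) (K - n) → Matrix (Fin 2) (Fin 2) ℂ,
        (∀ e : PBond (F.P K) (K - n), cf e.src = ((emlIterU (K - n) (bgUnits F K U₀) e : (Matrix (Fin 2) (Fin 2) ℂ)ˣ) : Matrix (Fin 2) (Fin 2) ℂ) * cf e.tgt *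
          (((emlIterU (K - n) (bgUnits F K U₀) e)⁻¹ : (Matrix (Fin 2) (Fin 2) ℂ)ˣ) : Matrix (Fin 2) (Fin 2) ℂ)) →
        ∃ l₀ : Site (F.P K) 0 → Matrix (Fin 2) (Fin 2) ℂ,
          (∀ b : PBond (F.P K) 0, l₀ b.src = ((bgUnits F K U₀ b : (Matrix (Fin 2) (Fin 2) ℂ)ˣ) : Matrix (Fin 2) (Fin 2) ℂ) * l₀ b.tgt * (((bgUnits F K U₀ b)⁻¹ : (Matrix (Fin 2) (Fin 2) ℂ)ˣ) : Matrix (Fin 2) (Fin 2) ℂ)) ∧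
          ∀ y : Site (F.P K) (K - n), l₀ (embIter (K - n) y) = cf y)
    {a a₁ : ℝ} (ha : 0 ≤ a) (ha₁ : a ≤ a₁ * (c₀ / cB) * ((F.L : ℝ) ^ (K - n)) ^ 3)
    {γ : ℝ} (hγ : 0 < γ) (hco : ∀ v : BondL2K ℂ 3 (periodsT3 F K) c₀ W₂, γ * ‖v‖ ^ 2 ≤ RCLike.re ⟪v, laplaceA F n K h c₀ cB a (DeltaEtaSlot F n K c₀) U₀ v⟫_ℂ)
    {CK δK : ℝ} (hCK : 0 ≤ CK) (hδK : 0 < δK)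
    (hkD : ∀ (b : PBond (F.P K) 0) (Z : Matrix (Fin 2) (Fin 2) ℂ) (bd : PBond (F.P K) 0),
      ‖(toL2 F K c₀).symm (DL2 F n K c₀ U₀ (DstarL2 F n K c₀ U₀ (toL2 F K c₀ (Pi.single b Z))
          - RS F n K h c₀ cB U₀ (DstarL2 F n K c₀ U₀ (toL2 F K c₀ (Pi.single b Z))))) bd‖
        ≤ CK * ((F.L : ℝ) ^ (K - n))⁻¹ ^ 3 * Real.exp (-(δK * (Site.tdist (P := F.P K) (iterBlockOf (K - n) b.src) (iterBlockOf (K - n) bd.src) : ℝ))) * ‖Z‖)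
    {r ε : ℝ} (hr : 0 < r) (hr4 : r ≤ 1 / 4) (hrδ : r ≤ δK / 2) (hε : 0 < ε) (hε8 : ε ≤ 1 / 8)
    (hεC : ε * (32 * Real.sqrt 2 * 648 + (33 / 8 : ℝ) ^ 2 * (600 * (27 / 4 : ℝ) ^ 6)) ≤ γ / 8) (hrγ : r ≤ γ * ε / 48)
    (hrT : r * (5000 * a₁ + 27 * Real.sqrt 2 * CK * (2 * (1 + 4 / δK)) ^ 3 / min 1 (δK / 4)) ≤ γ / 16) (hαγ : 10 ^ 5 * ε₀ ≤ γ / 16)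
    (hroom : 2 * (12 * F.L ^ (K - n) + 5) ≤ (F.P K).sitesPerDir 0)
    (hsmall : exists_curved_localGradient.choose * ((48 * ε₀) * (6 * Real.sqrt 2 * Real.sqrt 10 + 6 * Real.sqrt 2)) * Real.exp (51 / 8) ≤ 1 / 2) :
    ∀ (X : PBond (F.P K) 0 → Matrix (Fin 2) (Fin 2) ℂ) (z : Site (F.P K) (K - n)), (∀ b, X b ≠ 0 → iterBlockOf (K - n) b.src = z) →
      ∀ s : ℝ, 0 ≤ s → (∀ b, ‖X b‖ ≤ s) →
        ∀ x : Site (F.P K) 0, ‖(toL2S F K c₀).symm (DstarL2 F n K c₀ U₀ (GT F n K h c₀ cB a (DeltaEtaSlot F n K c₀) U₀ (toL2 F K c₀ X))) x‖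
          ≤ s * (3 * (Real.exp (4 / 8) * (2 * ((exists_curved_localGradient.choose * (((Real.sqrt 2 * (2 * ((Real.sqrt 2 + Real.sqrt 2 * ((50 * a₁ * Real.exp δK + CK) * (3 * Real.sqrt 2) * (Real.exp (6 * r) * (2 / γ)) * (2 * (1 + 2 / δK)) ^ 3)) * (8 * Real.exp (3 * r)) * 14 + 36 * (Real.sqrt (8 * Real.exp (3 * r) * (2 * (1 + 1 / r)) ^ 3) * (Real.exp (6 * r) * (2 / γ)))))) * Real.exp (51 / 8)) * (2 + 2 * Real.sqrt 2 * (4 * ε₀ * (3 + 2457 * norm_bgOfCfg_axialT_sub_le.choose)) + (24 * Real.sqrt 10 + 48) * (48 * ε₀) ^ 2) + (Real.sqrt 2 * ((32 * ε₀ * ((2 * ((Real.sqrt 2 + Real.sqrt 2 * ((50 * a₁ * Real.exp δK + CK) * (3 * Real.sqrt 2) * (Real.exp (6 * r) * (2 / γ)) * (2 * (1 + 2 / δK)) ^ 3)) * (8 * Real.exp (3 * r)) * 14 + 36 * (Real.sqrt (8 * Real.exp (3 * r) * (2 * (1 + 1 / r)) ^ 3) * (Real.exp (6 * r) * (2 /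 γ))))) * Real.exp (5 / 8))) + (CK * (3 * Real.sqrt 2) * (Real.exp (6 * r) * (2 / γ)) * (2 * (1 + 2 / δK)) ^ 3) + ((50 * a₁ * Real.exp δK) * (3 * Real.sqrt 2) * (Real.exp (6 * r) * (2 / γ)) * (2 * (1 + 2 / δK)) ^ 3) + 1)) * Real.exp (51 / 8)) + 2 * Real.sqrt 2 * (48 * ε₀) * ((Real.sqrt 2 * (2 * ((Real.sqrt 2 + Real.sqrt 2 * ((50 * a₁ * Real.exp δK + CK) * (3 * Real.sqrt 2) * (Real.exp (6 * r) * (2 / γ)) * (2 * (1 + 2 / δK)) ^ 3)) * (8 * Real.exp (3 * r)) * 14 + 36 * (Real.sqrt (8 * Real.exp (3 * r) * (2 * (1 + 1 / r)) ^ 3) * (Real.exp (6 * r) * (2 / γ)))))) * Real.exp (51 / 8)))))))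
            * Real.exp (-((min r (1 / 4) / 2) * (Site.tdist (P := F.P K) (iterBlockOf (K - n) x) z : ℝ))) := by
  intro X z hXz s hs hX x
  have hc₀ : 0 < c₀ := Fact.out
  have hcB : 0 < cB := Fact.out
  have hd : (F.P K).d = 3 := rfl
  have hL2 : (2 : ℝ) ≤ F.L := by exact_mod_cast F.hL.2
  have hLr : (1 : ℝ) ≤ F.L := le_trans one_le_two hL2
  have hε5 : ε₀ ≤ (10 : ℝ)⁻¹ ^ 5 := by
    have h1 : 10 ^ 12 * ε₀ ≤ 10 ^ 12 * (F.L : ℝ) ^ 3 * ε₀ := by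
      have hL3 : (1 : ℝ) ≤ (F.L : ℝ) ^ 3 := one_le_pow₀ hLr
      nlinarith [hε₀.le]
    have h2 : 10 ^ 12 * ε₀ ≤ 1 := h1.trans hWε
    rw [inv_pow]
    rw [le_inv_comm₀ hε₀ (by positivity)]
    calc (10 : ℝ) ^ 5 ≤ 10 ^ 12 := by norm_num
      _ ≤ ε₀⁻¹ := by rw [le_inv_comm₀ (by positivity) hε₀]; exact (le_div_iff₀' (by positivity)).mpr (by linarith) |>.trans (le_of_eq (one_div _))
  have hε1 : ε₀ ≤ 1 := hε5.trans (by norm_num)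
  have hεle1 : ε ≤ 1 := by linarith
  -- the four budgets ⟹ `Θ ≥ γ∕2`; the value window
  have hθ := thetaV_le_kfree hd hLr (K - n) hc₀ hcB ha ha₁ hCK hδK hr hr4 hrδ hε₀.le
  have hθ8 := hθ.trans (show r * (5000 * a₁ + 27 * Real.sqrt 2 * CK * (2 * (1 + 4 / δK)) ^ 3 / min 1 (δK / 4)) + 10 ^ 5 * ε₀ ≤ γ / 8 by linarith)
  have hεC' := (mul_le_mul_of_nonneg_left (CV_abs_le hd hε1) hε.le).trans hεC
  have hR := (rbudget_le hγ.le hr hr4 hε (by linarith) hrγ).trans (show γ / 16 ≤ γ / 8 by linarith [hγ.le])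
  have hΘ := theta_ge_half_of_budgets hγ.le hε8 hεC' hR hθ8
  have hΘpos := lt_of_lt_of_le (by positivity : (0 : ℝ) < γ / 2) hΘ
  have hS := hsmall_le_half hr4 hε₀.le hε5
  have hSV := lt_of_le_of_lt hS (by norm_num : (1 : ℝ) / 2 < 1)
  have hrμ : r < δK := by linarith
  have hCkD : 0 ≤ CK * ((F.L : ℝ) ^ (K - n))⁻¹ ^ 3 := by positivity
  have hdr : 0 < δK - r := by linarith
  have hS30 : 0 ≤ (2 * (1 + 1 / (δK - r))) ^ 3 := pow_nonneg (by have := div_nonneg zero_le_one hdr.le; linarith) 3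
  have hCg := exists_curved_localGradient.choose_spec.1
  have hC := norm_bgOfCfg_axialT_sub_le.choose_spec.1
  have e4B : (4 : ℝ) * ((Real.sqrt 2 + Real.sqrt 2 * ((50 * a₁ * Real.exp δK + CK) * (3 * Real.sqrt 2) * (Real.exp (6 * r) * (2 / γ)) * (2 * (1 + 2 / δK)) ^ 3)) * (8 * Real.exp (3 * r)) * 14 + 36 * (Real.sqrt (8 * Real.exp (3 * r) * (2 * (1 + 1 / r)) ^ 3) * (Real.exp (6 * r) * (2 / γ)))) = 2 * (2 * ((Real.sqrt 2 + Real.sqrt 2 * ((50 * a₁ * Real.exp δK + CK) * (3 * Real.sqrt 2) * (Real.exp (6 * r) * (2 / γ)) * (2 * (1 + 2 / δK)) ^ 3)) * (8 * Real.exp (3 * r)) * 14 + 36 * (Real.sqrt (8 * Real.exp (3 * r) * (2 * (1 + 1 / r)) ^ 3) * (Real.exp (6 * r) * (2 / γ))))) := by ring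
  -- numerics: every member-dependent atom of `C_D` under its K-free majorant (pure reals, before the big terms enter the context)
  have hA := twoA₂_le_kfree hd hLr (K - n) hc₀ hcB ha ha₁ hCK hδK hr hr4 hrδ hγ hΘ hε₀.le hε5
  have hAV := le_of_mul_le_mul_left (hA.trans_eq e4B) (two_pos : (0 : ℝ) < 2)
  obtain ⟨hWD, hWQ⟩ := words_le_kfree hd hLr (K - n) hc₀ hcB ha ha₁ hCK hδK hr hrδ hγ hΘ
  -- the fed letters (A2i's knit)
  have hp : PosOnto F n K h c₀ cB a (DeltaEtaSlot F n K c₀) U₀ :=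
    ⟨fun v hv => lt_of_lt_of_le (mul_pos hγ (pow_pos (norm_pos_iff.mpr hv) 2)) (hco v), surjective_Qk_of_regPr F h hnK c₀ cB hreg hwin⟩
  have hQ : ∀ v : BondL2K ℂ 3 (periodsT3 F K) c₀ W₂, ‖Qk F n K h c₀ cB U₀ v‖ ≤ (6 * Real.sqrt (cB / c₀) * Real.sqrt (((F.L : ℝ) ^ (K - n))⁻¹ ^ 3)) * ‖v‖ :=
    fun v => norm_Qk_le_of_regPr F h c₀ cB hε₀ hε10 hWε U₀ hreg v
  have hVconj := hVconj_phaseClass_of_letters F h c₀ cB (a := a) hε₀ hε10 hWε U₀ hreg ha hr.le hrμ hCkD hkD hQ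
  have hVlow := hVlow_abs_of_lift F h c₀ cB (a := a) hnK hε₀ hWε U₀ hreg ha hlift
  have hkQ := hkQ_of_regPr F h c₀ cB hε₀ hε10 hWε U₀ hreg ha (le_of_lt (hr.trans hrμ))
  -- the decayed VALUE row (px16 §3), fed
  have hval := fun bd : PBond (F.P K) 0 =>
    norm_symm_GT_apply_le_of_blockSupport (h := h) (cB := cB) (a := a) hnK.le hε₀.le U₀ hreg hp hr hε hεle1 hco hVlow hVconj hΘpos hCkD
      (by positivity) hrμ hkD hkQ hSV X z hXz hs hX bd
  -- the gradient margin at `κ₁ ≤ ⅛`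
  have hsmallκ : exists_curved_localGradient.choose * ((48 * ε₀) * (6 * Real.sqrt 2 * Real.sqrt 10 + 6 * Real.sqrt 2)) * Real.exp (51 * (min r (1 / 4) / 2)) ≤ 1 / 2 :=
    (mul_le_mul_of_nonneg_left (exp_mul_kappa_le (r := r) (by norm_num : (0 : ℝ) ≤ 51))
      (mul_nonneg exists_curved_localGradient.choose_spec.1 (by positivity))).trans hsmall
  -- (dκ) at the member with every letter fed
  have main := norm_symm_DstarL2_GT_le_of_blockSupport F c₀ U₀ (h := h) (cB := cB) (a := a) hnK.le hε₀ hε1 hreg hp hr hε hεle1 hco hVlow hVconj hΘpos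
    hCkD (by positivity) hrμ hkD hkQ X z hXz hs hX hval hroom hsmallκ x
  rcases hs.eq_or_lt with h0 | hpos
  · -- `s = 0`: both sides vanish
    refine main.trans (le_of_eq ?_)
    rw [← h0]; simp only [zero_mul]
  · -- `0 < s`: the sign of `A_V` is read off the value row at one bond, then monotonicity
    have hb := hval ⟨x, ⟨0, by rw [T3Family.P_d]; norm_num⟩⟩
    have hAV0 := (mul_nonneg_iff_of_pos_left hpos).mp ((mul_nonneg_iff_of_pos_right (Real.exp_pos _)).mp ((norm_nonneg _).trans hb))
    have mono := CD_mono (Cg := exists_curved_localGradient.choose) (ε₀ := ε₀)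
      (cε := (2 + 2 * Real.sqrt 2 * (4 * ε₀ * (3 + 2457 * norm_bgOfCfg_axialT_sub_le.choose)) + (24 * Real.sqrt 10 + 48) * (48 * ε₀) ^ 2))
      (lAV := hAV) (lWD := hWD) (lWQ := hWQ)
      (l4 := exp_mul_kappa_le (r := r) (by norm_num : (0 : ℝ) ≤ 4))
      (l51 := exp_mul_kappa_le (r := r) (by norm_num : (0 : ℝ) ≤ 51))
      (l5 := exp_mul_kappa_le (r := r) (by norm_num : (0 : ℝ) ≤ 5))
      hCg (by positivity) hε₀.le (Real.exp_pos _).le hAV0 (Real.exp_pos _).le (Real.exp_pos _).le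
      (by exact mul_nonneg (mul_nonneg (mul_nonneg hCkD (Real.sqrt_nonneg _)) (div_nonneg (by positivity) hΘpos.le)) hS30)
      (by exact mul_nonneg (mul_nonneg (by positivity) (div_nonneg (by positivity) hΘpos.le)) hS30)
    exact main.trans (mul_le_mul_of_nonneg_right (mul_le_mul_of_nonneg_left mono hs) (Real.exp_pos _).le)

end Member

end Summit.QuantumFields.YangMills.Theorems.Prop7OneFormGreenBlockDivergenceKFree

end
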